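import Summits.CriticalPhenomena.PercolationContinuityZ3.Theorems.PercNearOneGluingNoHeavyLowerTailSahiCTCLadderThreeRowThreeChain
import HarnessLib

/-!
# `NoHeavyLowerTail` (crux stmt-CriticalPhenomena-4575), P3 lane: the Q-graphs of the row `#dbl = 3` of `(L_3)` (T-vertex degrees)

Support file (seat `prim-l12-p3`, gen 26; `--supports stmt-CriticalPhenomena-4575`).  Paper proof `prim-l12-p3/ROW3-PROOF-g26.md` §3 (L2-T),
§5 (b).  For `d ∈ D` the charged sets `d + Q`, `Q ⊆ T` a pair, form a graph `qset m d` on `T` with degrees `qdeg m d v`; this file proves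
the handshake identity `Σ_v qdeg = 2·#qset` (`sum_qdeg_eq`), the summed T-vertex DEGREE bound
`Σ_{y₀} κ₂(d,y₀) ≥ (τ+1) + (τ−2)·qdeg v` when `D` is common (`sum_kapL2_ge_tdeg_alpha`), and the arithmetic elimination of the Q-data:
`(2τ−4)(L − q) ≥ L₀(τ−4) + τ(τ+1)` whenever `L ≥ L₀`, `L ≥ τ+1+(τ−2)Δ` and `2q ≤ τΔ` (`psi_one_bound`).  Nothing is asserted about the crux.
-/

namespace Summit.CriticalPhenomena.PercolationContinuityZ3.Theorems.SahiCTCForms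

open Finset MvPolynomial SahiCTCGenFun SahiCTCWeightedLYM

variable {α : Type*} [DecidableEq α] [Fintype α]

section RowThreeDegree
variable {𝒳 𝒵 : Finset (Finset α)}

/-- The Q-graph at `d`: pairs `Q ⊆ T` with `d + Q ∈ 𝒳 ∩ 𝒵`. [this work] -/
def qset (𝒳 𝒵 : Finset (Finset α)) (m : α →₀ ℕ) (d : α) : Finset (Finset α) :=
  ((lev m 1).powersetCard 2).filter fun Q => insert d Q ∈ 𝒳 ∧ insert d Q ∈ 𝒵

/-- The degree of `v` in the Q-graph at `d`. [this work] -/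
def qdeg (𝒳 𝒵 : Finset (Finset α)) (m : α →₀ ℕ) (d v : α) : ℕ := #((qset 𝒳 𝒵 m d).filter fun Q => v ∈ Q)

omit [Fintype α] in
/-- **Handshake**: `Σ_{v ∈ T} qdeg v = 2·#qset`. [folklore] -/
theorem sum_qdeg_eq (m : α →₀ ℕ) (d : α) : ∑ v ∈ lev m 1, qdeg 𝒳 𝒵 m d v = 2 * #(qset 𝒳 𝒵 m d) := by
  unfold qdeg
  have h := sum_card_bipartiteAbove_eq_sum_card_bipartiteBelow (s := lev m 1) (t := qset 𝒳 𝒵 m d) (r := fun v Q => v ∈ Q)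
  simp only [bipartiteAbove, bipartiteBelow] at h
  rw [h]
  have : ∀ Q ∈ qset 𝒳 𝒵 m d, #((lev m 1).filter fun v => v ∈ Q) = 2 := fun Q hQ => by
    obtain ⟨hQT, hQ2⟩ := mem_powersetCard.1 (mem_filter.1 hQ).1
    rw [show ((lev m 1).filter fun v => v ∈ Q) = Q from by
      ext v; simp only [mem_filter, and_iff_right_iff_imp]; exact fun hv => hQT hv, hQ2]
  rw [sum_congr rfl this, sum_const, smul_eq_mul, mul_comm]

omit [Fintype α] in
/-- Hence `2·#qset ≤ τ·Δ` for any bound `Δ` on the degrees. [this work] -/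
theorem two_mul_card_qset_le (m : α →₀ ℕ) (d : α) {Δ : ℕ} (hΔ : ∀ v ∈ lev m 1, qdeg 𝒳 𝒵 m d v ≤ Δ) :
    2 * #(qset 𝒳 𝒵 m d) ≤ #(lev m 1) * Δ := by
  rw [← sum_qdeg_eq]
  exact (sum_le_sum hΔ).trans (by rw [sum_const, smul_eq_mul])

omit [Fintype α] in
/-- The neighbours of `v` in the Q-graph, as points of `T`. [this work] -/
theorem card_qnbrs_eq (m : α →₀ ℕ) (d v : α) :
    #((lev m 1).filter fun u => u ≠ v ∧ ({v, u} : Finset α) ∈ qset 𝒳 𝒵 m d) = qdeg 𝒳 𝒵 m d v := by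
  unfold qdeg
  refine card_bij (fun u _ => ({v, u} : Finset α)) (fun u hu => ?_) (fun u hu u' hu' h => ?_) (fun Q hQ => ?_)
  · obtain ⟨_, _, hQ⟩ := mem_filter.1 hu
    exact mem_filter.2 ⟨hQ, mem_insert_self _ _⟩
  · obtain ⟨_, hne, _⟩ := mem_filter.1 hu
    obtain ⟨_, hne', _⟩ := mem_filter.1 hu'
    have : u ∈ ({v, u'} : Finset α) := by rw [← show ({v, u} : Finset α) = {v, u'} from h]; simp
    rcases mem_insert.1 this with h' | h'
    · exact absurd h' hne
    · exact mem_singleton.1 h'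
  · obtain ⟨hQ, hvQ⟩ := mem_filter.1 hQ
    obtain ⟨hQT, hQ2⟩ := mem_powersetCard.1 (mem_filter.1 hQ).1
    obtain ⟨u, hu⟩ : (Q.erase v).Nonempty := card_pos.1 (by rw [card_erase_of_mem hvQ, hQ2]; norm_num)
    have hQeq : ({v, u} : Finset α) = Q := by
      apply eq_of_subset_of_card_le (insert_subset hvQ (singleton_subset_iff.2 (mem_of_mem_erase hu)))
      rw [hQ2, card_pair (ne_of_mem_erase hu).symm]
    exact ⟨u, mem_filter.2 ⟨hQT (mem_of_mem_erase hu), ne_of_mem_erase hu, hQeq ▸ hQ⟩, hQeq⟩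

/-- **Summed T-vertex DEGREE** (with the α-edge): if `D ∈ 𝒳 ∩ 𝒵` then for every `v ∈ T`,
`Σ_{y₀ ∈ T} κ₂(d,y₀) ≥ (τ + 1) + (τ − 2)·qdeg v` (`τ ≥ 2`). [this work] -/
theorem sum_kapL2_ge_tdeg_alpha (h𝒳 : IsUpperSet (𝒳 : Set (Finset α))) (h𝒵 : IsUpperSet (𝒵 : Set (Finset α)))
    (hX3 : ∀ S ∈ 𝒳, 3 ≤ #S) (hZ3 : ∀ S ∈ 𝒵, 3 ≤ #S) {m : α →₀ ℕ} (hD : #(dbl m) = 3) (hτ : 2 ≤ #(lev m 1)) {d : α} (hd : d ∈ dbl m)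
    (hDX : dbl m ∈ 𝒳) (hDZ : dbl m ∈ 𝒵) {v : α} (hv : v ∈ lev m 1) :
    ((#(lev m 1) : ℤ) + 1) + ((#(lev m 1) : ℤ) - 2) * qdeg 𝒳 𝒵 m d v ≤ ∑ y₀ ∈ lev m 1, kapL2 𝒳 𝒵 m d y₀ := by
  set N := (lev m 1).filter fun u => u ≠ v ∧ ({v, u} : Finset α) ∈ qset 𝒳 𝒵 m d with hN
  have hNcard : (#N : ℤ) = qdeg 𝒳 𝒵 m d v := by exact_mod_cast card_qnbrs_eq m d v
  have hNT : N ⊆ lev m 1 := filter_subset _ _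
  -- the α-edge gives κ₂ ≥ 2 on every cube
  have h2 : #((dbl m).erase d) = 2 := by rw [card_erase_of_mem hd, hD]
  obtain ⟨x, hx⟩ : ((dbl m).erase d).Nonempty := card_pos.1 (by omega)
  have htwo : ∀ y₀ ∈ lev m 1, (2 : ℤ) ≤ kapL2 𝒳 𝒵 m d y₀ := fun y₀ hy₀ => by
    obtain ⟨x', hx'⟩ : (((dbl m).erase d).erase x).Nonempty := card_pos.1 (by rw [card_erase_of_mem hx, h2]; norm_num)
    have hx'D : x' ∈ (dbl m).erase d := mem_of_mem_erase hx'
    have hxx' : x' ≠ x := ne_of_mem_erase hx'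
    have hDeq : insert d {x, x'} = dbl m := by
      apply eq_of_subset_of_card_le
      · exact insert_subset hd (insert_subset (mem_of_mem_erase hx) (singleton_subset_iff.2 (mem_of_mem_erase hx'D)))
      · rw [hD, card_insert_of_notMem, card_pair hxx'.symm]
        simp only [mem_insert, mem_singleton, not_or]
        exact ⟨(ne_of_mem_erase hx).symm, (ne_of_mem_erase hx'D).symm⟩
    have h := card_add_one_le_kapL2_of_nbrs h𝒳 h𝒵 hX3 hZ3 hD hd hy₀ hτ (v := x) (mem_union_left _ hx) (S := {x'})
      (fun u hu => by rw [mem_singleton.1 hu]; exact mem_erase.2 ⟨hxx', mem_union_left _ hx'D⟩)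
      (fun u hu => by rw [mem_singleton.1 hu, hDeq]; exact ⟨hDX, hDZ⟩) (singleton_nonempty _)
    rw [card_singleton] at h; push_cast at h; linarith
  -- at y₀ ≠ v: the Q-neighbours of v other than y₀
  have hper : ∀ y₀ ∈ (lev m 1).erase v, (1 : ℤ) + #(N.erase y₀) ≤ kapL2 𝒳 𝒵 m d y₀ := fun y₀ hy₀ => by
    have hy₀T := mem_of_mem_erase hy₀
    by_cases hne : (N.erase y₀).Nonempty
    · have h := card_add_one_le_kapL2_of_nbrs h𝒳 h𝒵 hX3 hZ3 hD hd hy₀T hτ (v := v)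
        (mem_union_right _ (mem_erase.2 ⟨(ne_of_mem_erase hy₀).symm, hv⟩)) (S := N.erase y₀)
        (fun u hu => by
          obtain ⟨huy₀, huN⟩ := mem_erase.1 hu
          obtain ⟨huT, huv, _⟩ := mem_filter.1 huN
          exact mem_erase.2 ⟨huv, mem_union_right _ (mem_erase.2 ⟨huy₀, huT⟩)⟩)
        (fun u hu => by
          obtain ⟨_, huN⟩ := mem_erase.1 hu
          obtain ⟨_, _, hQ⟩ := mem_filter.1 huN
          have := (mem_filter.1 hQ).2
          rwa [show insert d ({v, u} : Finset α) = insert d {v, u} from rfl] at this) hne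
      linarith
    · rw [not_nonempty_iff_eq_empty.1 hne, card_empty]; push_cast; linarith [htwo y₀ hy₀T]
  have hNT' : N ⊆ (lev m 1).erase v := fun u hu => mem_erase.2 ⟨(mem_filter.1 hu).2.1, (mem_filter.1 hu).1⟩
  have hsum := sum_le_sum hper
  rw [sum_add_distrib, sum_const, nsmul_eq_mul, mul_one, sum_card_erase_eq hNT'] at hsum
  have hTe : (#((lev m 1).erase v) : ℤ) = #(lev m 1) - 1 := by
    have := card_erase_add_one hv; omega
  have hsplit := sum_erase_add (lev m 1) (fun y₀ => kapL2 𝒳 𝒵 m d y₀) hv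
  rw [← hsplit]
  have hv2 := htwo v hv
  rw [hTe, hNcard] at hsum
  nlinarith [hsum, hv2]

/-- **Elimination of the Q-data** (ROW3-PROOF §5 (b)): if `L ≥ L₀`, `L ≥ τ+1+(τ−2)Δ` and `2q ≤ τΔ` (`τ ≥ 4`, `Δ ≥ 0`) then
`(2τ−4)(L − q) ≥ L₀(τ−4) + τ(τ+1)`. [this work] -/
theorem psi_one_bound {τ L L₀ q Δ : ℤ} (hτ : 4 ≤ τ) (hL : L₀ ≤ L) (hT : τ + 1 + (τ - 2) * Δ ≤ L) (hq : 2 * q ≤ τ * Δ) :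
    L₀ * (τ - 4) + τ * (τ + 1) ≤ (2 * τ - 4) * (L - q) := by
  have p1 := mul_le_mul_of_nonneg_left hq (by linarith : (0 : ℤ) ≤ τ - 2)
  have p2 := mul_le_mul_of_nonneg_left hT (by linarith : (0 : ℤ) ≤ τ)
  have p3 := mul_le_mul_of_nonneg_right hL (by linarith : (0 : ℤ) ≤ τ - 4)
  nlinarith [p1, p2, p3]

end RowThreeDegree

end Summit.CriticalPhenomena.PercolationContinuityZ3.Theorems.SahiCTCForms
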